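import Mathlib
import Summits.ABC.ABC.Theses.TwistAmplification

/-!
# Sketch — crux-ideate stmt-ABC-1975 (SharpModerateLaw), ideator 1, round 1

First lemmas of the two idea cards, stated over existing declarations (Mathlib + the route file).
Nothing here is proved; the point is that the signatures elaborate.
-/

namespace Summit.ABC.ABC.Cruxes.SharpModerateLaw.Ideator1

open scoped BigOperators

/-! ## Binary cubic forms: evaluation, discriminant, radical-type invariants (all elementary) -/

/-- `F(u,v) = a u³ + b u² v + c u v² + d v³`. -/
def cubicEval (F : ℤ × ℤ × ℤ × ℤ) (u v : ℤ) : ℤ :=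
  F.1 * u ^ 3 + F.2.1 * u ^ 2 * v + F.2.2.1 * u * v ^ 2 + F.2.2.2 * v ^ 3

/-- Discriminant `b²c² − 4ac³ − 4b³d − 27a²d² + 18abcd` of the binary cubic form `(a,b,c,d)`. -/
def cubicDisc (F : ℤ × ℤ × ℤ × ℤ) : ℤ :=
  F.2.1 ^ 2 * F.2.2.1 ^ 2 - 4 * F.1 * F.2.2.1 ^ 3 - 4 * F.2.1 ^ 3 * F.2.2.2
    - 27 * F.1 ^ 2 * F.2.2.2 ^ 2 + 18 * F.1 * F.2.1 * F.2.2.1 * F.2.2.2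

/-- `‖F‖ = |a| + |b| + |c| + |d|`. -/
def cubicHeight (F : ℤ × ℤ × ℤ × ℤ) : ℤ := |F.1| + |F.2.1| + |F.2.2.1| + |F.2.2.2|

/-- Radical of a natural number as the product of its prime factors (`= UniqueFactorizationMonoid.radical`
for `n ≠ 0`, cf. `Nat.radical_eq_prod_primeFactors`). -/
def nrad (n : ℕ) : ℕ := ∏ p ∈ n.primeFactors, p

/-- The part of `n` coprime to `m`: `∏_{p ∣ n, p ∤ m} p^{v_p(n)}`. -/
def coprimePart (m n : ℕ) : ℕ := ∏ p ∈ n.primeFactors with ¬ p ∣ m, p ^ n.factorization p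

/-- Kane's "repeated radical" `v(n) = ∏_{p² ∣ n} p`. -/
def repeatedRad (n : ℕ) : ℕ := ∏ p ∈ n.primeFactors with p ^ 2 ∣ n, p

/-! ## Card `syzygy-lattice-half-deep-few-primes` — first lemma

KANE'S LATTICE HALF TRANSPLANTED TO BINARY CUBIC FORMS (uniformly in the form). For an integral
binary cubic form `F` with non-zero discriminant `D`, a box `R`, a radical budget `B`, a size floor
`V` for the part `n♭` of `n = F(u,v)` coprime to `6D`, and a cap `w` on the repeated radical of `n♭`:
the number of coprime `(u,v)` in the box with `rad(n) ≤ B`, `|n♭| ≥ V`, `v(n♭) ≤ w` is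
`≤ C_ε (‖F‖·R·B)^ε · (R²·B/V + w)`.  (Proof sketch: fix `v(n♭)` (≤ w values) and `e(n♭)` (≤ N^ε values
by Kane's Prop. 5); for `p ∤ 6D` the roots of `F(θ,1) ≡ 0 (p^α)` are ≤ 3 Hensel lifts, so `(u,v)`
lies in one of `≤ 3^{ω(e)}` sublattices of index `e`; Kane's Lemma 4 gives `O(R²/e + 1)` primitive
points each, and `e ≥ V·v/B` because `n♭/e` is squarefree of radical `≤ B/v`.) -/
def LatticeHalf : Prop :=
  ∀ ε : ℝ, 0 < ε → ∃ C : ℝ, 0 < C ∧ ∀ F : ℤ × ℤ × ℤ × ℤ, cubicDisc F ≠ 0 →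
    ∀ R B V w : ℝ, 1 ≤ R → 1 ≤ B → 1 ≤ V → 1 ≤ w →
      (Set.ncard {q : ℤ × ℤ | IsCoprime q.1 q.2 ∧ |q.1| ≤ R ∧ |q.2| ≤ R ∧ cubicEval F q.1 q.2 ≠ 0 ∧
          (nrad (cubicEval F q.1 q.2).natAbs : ℝ) ≤ B ∧
          V ≤ (coprimePart (6 * (cubicDisc F).natAbs) (cubicEval F q.1 q.2).natAbs : ℝ) ∧
          (repeatedRad (coprimePart (6 * (cubicDisc F).natAbs) (cubicEval F q.1 q.2).natAbs) : ℝ) ≤ w} : ℝ)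
        ≤ C * ((cubicHeight F : ℝ) * R * B) ^ ε * (R ^ 2 * B / V + w)

/-! ## The dictionary behind both cards (Cayley syzygy; for the record, provable by `ring`)

For `F = (a,b,c,d)` with Hessian `H = (b²−3ac, bc−9ad, c²−3bd)` and cubic covariant `G`, one has
`G² + 27·D·F² = 4·H³`; with `c₄ = H(u,v)/9`, `c₆ = −G(u,v)/54` this reads
`c₄³ − c₆² = D·F(u,v)²/108`, i.e. `1728·Δ = D·F(u,v)²/108`. The `(1,0)`-normal form of the
2-division cubic of a curve with invariants `(c₄, c₆)` is `F₀ = (1, 0, −3c₄, −2c₆)`, `D(F₀) = 108(c₄³−c₆²)`. -/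
theorem syzygy_normal_form (c4 c6 : ℤ) :
    cubicDisc (1, 0, -3 * c4, -2 * c6) = 108 * (c4 ^ 3 - c6 ^ 2) := by
  simp [cubicDisc]; ring

/-! ## Card `unit-plane-conic-two-torsion` — first lemma

BHARGAVA'S MEAN 2-TORSION OF CUBIC FIELDS in the shape the line consumes it (a named fact to vendor,
Bhargava, Ann. of Math. 162 (2005), Thm. 5: the average size of `Cl(K)[2]` over cubic fields ordered by
`|d_K|` is `5/4` (totally real) / `3/2` (complex)): the total 2-torsion over any finite family of pairwise
non-isomorphic cubic number fields of absolute discriminant `≤ Z` is `≤ C·Z`. -/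
def BhargavaMeanTwoTorsionCubic : Prop :=
  ∃ C : ℝ, 0 < C ∧ ∀ Z : ℝ, 1 ≤ Z → ∀ (n : ℕ) (K : Fin n → Type) [∀ i, Field (K i)] [∀ i, NumberField (K i)],
    (∀ i, Module.finrank ℚ (K i) = 3) →
    (∀ i j, Nonempty (K i ≃+* K j) → i = j) →
    (∀ i, (|NumberField.discr (K i)| : ℝ) ≤ Z) →
    (∑ i, (Nat.card {c : ClassGroup (NumberField.RingOfIntegers (K i)) // c ^ 2 = 1} : ℝ)) ≤ C * Z

/-! ## Target of both lines, by name (the crux is fixed) -/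
example : Prop := Summit.ABC.ABC.Theses.TwistAmplification.SharpModerateLaw

end Summit.ABC.ABC.Cruxes.SharpModerateLaw.Ideator1
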